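import Mathlib
import Summits.NavierStokesRegularity.NavierStokesRegularity.Theses.OrthantWake
import HarnessLib

/-!
# `OrthantWake.Assembly` — the route's assembly (item stmt-NavierStokesRegularity-24643;
  pure logic)

**Statement.** `OrthantHopWake → OrthantInvariance → OrthantBreakOfWake → NonOrthantBreak →
TaoLadderRungTwoBreak.Target`.

PROOF. The route file `Theses/OrthantWake.lean` carries the planner-authored, kernel-checked
deciding theorem `Theses.OrthantWake.closes`, whose hypotheses are exactly the route's three
cruxes and its support and whose conclusion is the rung leaf `TaoLadderRungTwoBreak.Target`
(TL-M2Break, D-0061): for `R ≥ 1` take `εR = min ε₁ ε₂` of the orthant conjunct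
(`OrthantBreakOfWake` fed with `OrthantHopWake`, `OrthantInvariance`) and the residual conjunct
(`NonOrthantBreak`), and split on whether the table is an orthant table. The assembly item is that
implication written as ONE proposition, so it is closed by applying `closes` to the hypotheses.

HONEST FRAMING: glue between the route's own statements about Tao-type MODEL lattice ODEs (rung
TL-M2Break); two of the four hypotheses (`OrthantHopWake`, `NonOrthantBreak`) are OPEN cruxes and
stay hypotheses; nothing here bears on Navier–Stokes regularity and no summit is proved.
-/

noncomputable section

set_option linter.dupNamespace false

namespace Summit.NavierStokesRegularity.NavierStokesRegularity.Theorems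

open Summit.NavierStokesRegularity.NavierStokesRegularity.Theses.OrthantWake in
/-- **Item stmt-NavierStokesRegularity-24643** (`OrthantWake.Assembly`): the route's three cruxes
and its support imply its rung leaf `TaoLadderRungTwoBreak.Target`, by the route file's deciding
theorem `closes`. [this file] -/
theorem orthantWake_assembly_proof :
    Summit.NavierStokesRegularity.NavierStokesRegularity.Theses.OrthantWake.Assembly := by
  unfold Summit.NavierStokesRegularity.NavierStokesRegularity.Theses.OrthantWake.Assembly
  -- (buildfix 2026-08-28) the route's `closes` was re-keyed to `ForwardHopWake` /
  -- `ForwardSourceSmoothing` / `ForwardBreakOfWake`; this CLOSED assembly keeps its accepted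
  -- statement over `OrthantHopWake` / `OrthantBreakOfWake`, so the pre-edit chain of `closes` is
  -- inlined verbatim: `εR = min ε₁ ε₂` (`ε₁` from `OrthantBreakOfWake`, `ε₂` from `NonOrthantBreak`),
  -- then split on the orthant case.
  intro h₁ h₂ h₃ h₄ R hR
  obtain ⟨ε₁, hε₁, H1⟩ := h₃ h₁ h₂ R hR
  obtain ⟨ε₂, hε₂, H2⟩ := h₄ R hR
  refine ⟨min ε₁ ε₂, lt_min hε₁ hε₂, ?_⟩
  intro ε₀ h0 hle α X₀ hα
  by_cases hO : (∀ (Y : Fin 4 → ℤ → ℝ → ℝ) (τ : ℝ), (∀ (j : Fin 4) (k : ℤ), 1 ≤ k → 0 ≤ Y j k τ) →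
      ∀ δ : ℝ, 0 < δ → ∀ (i : Fin 4) (n : ℤ), 1 ≤ n → Y i n τ = 0 →
        0 ≤ Literature.Analysis.FluidPDE.TaoCascade.quadTerm δ α Y i n τ)
  · exact H1 ε₀ h0 (hle.trans (min_le_left _ _)) α X₀ hα hO
  · exact H2 ε₀ h0 (hle.trans (min_le_right _ _)) α X₀ hα hO

end Summit.NavierStokesRegularity.NavierStokesRegularity.Theorems

end
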